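import Literature.AlgebraicGeometry.HodgeTheory.AbelianVarietyTangentOfDualNumber
import Literature.AlgebraicGeometry.Motives.AbelianVarietyTranslation
import Literature.NumberTheory.Transcendental.AnalytificationCoordinateHolomorphyTransport
import Literature.Geometry.Kaehler.ComplexTorusMapsLinear
import HarnessLib

/-!
# `ℂ[ε]`-points of a complex abelian variety along the torus uniformisation `φ : V/Λ → B(ℂ)`

Layer `Literature/AlgebraicGeometry/HodgeTheory`, namespace `Literature.AlgebraicGeometry.Motives.AbelianVariety`.
THEOREMS ONLY (no definition, no named fact, no instance).  Sequel of ★ `AbelianVarietyTangentOfDualNumber`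
(the identification `T_x B ≅ V` at any point of an analytification by `V = ℂ^{dim B}`), specialised to the torus
uniformisation `φ : V/Λ → B(ℂ)` compatible with the group laws (`φ (x + y) = φ x * φ y`, the shape of ★
`complexAbelianVariety_torusUniformised`), [MumfordAV1970] §1 (1)–(2), [LangeBirkenhake1992] §1.1.5:

* `uniformisation_apply_zero`, `pt_uniformisation_zero` (`φ 0 = e`);
* **`existsUnique_tangentVector_of_dualNumber`** — a `ℂ[ε]`-point `w` through the origin `e` has a UNIQUE tangent
  vector `v ∈ V`: `(dualNumberStalkHom w (germ s)).snd = ∂_v (s ∘ φ ∘ π)(χ₀ 0)` for all regular `s` near `e`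
  (`χ₀⁻¹ = π ∘ Φ⁻¹`, ★ `ComplexTorus.chart_symm_apply`); `exists_eq_toUnit_comp_of_tangentVector_eq_zero`
  (`v = 0` ⇒ `w` constant);
* junction lemmas (B-p19 (g10/g11) of the M13 cell, filed here with attribution per the cell's split plan R110):
  `eq_closedPoint_dualNumber` (`Spec ℂ[ε]` is one point), `exists_point_pt_eq_dualNumberBasePt`,
  `dualNumberBasePt_comp`, `dualNumberBasePt_comp_translation` / `…_inv` (base points of translated
  `ℂ[ε]`-points), `differentiableOn_evalOrZero_comp_cover` (regular functions are holomorphic on the universal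
  cover, [SerreGAGA1956] §2 n°6), and **`snd_dualNumberStalkHom_translation_eq_fderiv`** — the `ε`-parts of the
  translate `w ≫ t_{φ(π z)}` are the derivatives `∂_v (s ∘ φ ∘ π)` AT `z` (translation invariance of the vector
  field read through the uniformisation; `Λ`-periodicity of `s ∘ φ ∘ π`), the input of the first-order rigidity
  computation of [MumfordAV1970] §13 (proof of the Theorem, pp. 125–130) on `V`.

## References

* D. Mumford, *Abelian Varieties* (1970): §1 (1)–(2); §13, proof of the Theorem pp. 125–130. [MumfordAV1970]
* H. Lange, Ch. Birkenhake, *Complex Abelian Varieties* (1992): §1.1.5 (T_0 X = V). [LangeBirkenhake1992]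
* J.-P. Serre, *Géométrie algébrique et géométrie analytique* (1956): §2 n°6. [SerreGAGA1956]
* U. Görtz, T. Wedhorn, *Algebraic Geometry I* (2nd ed. 2020): (6.3)–(6.4) (tangent space via `k[ε]`). [GortzWedhorn2020]
* R. Hartshorne, *Algebraic Geometry* (1977): Ch. II, Exercise 2.8 (p. 80) (`Spec k[ε]/ε²` and tangent vectors). [Hartshorne1977]
-/

set_option autoImplicit false

noncomputable section

universe u

open CategoryTheory CategoryTheory.Limits AlgebraicGeometry Topology Filter TopologicalSpace MonoidalCategory
open scoped Manifold ContDiff DualNumber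
open Literature.AlgebraicGeometry.Motives (AlgPoints ComplexPoints SchemeOver AbelianVariety)
open Literature.AlgebraicGeometry.Motives.AlgPoints
open Literature.Geometry.Kaehler (ComplexTorus)
open Literature.NumberTheory.Transcendental Literature.NumberTheory.Transcendental.IsAnalytification
open Literature.AlgebraicGeometry.HodgeTheory

namespace Literature.AlgebraicGeometry.Motives.AbelianVariety

/-! ## The identification at the origin of a uniformised complex abelian variety -/

section Torus

variable {B : AbelianVariety ℂ} {ι : Type} [Fintype ι]
  {Φ : (ι → ℝ) ≃L[ℝ] (Fin B.dim → ℂ)} {φ : ComplexTorus Φ → ComplexPoints B.X}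

omit [Fintype ι] in
/-- A uniformisation compatible with the group laws sends `0` to the unit point. [cite: MumfordAV1970, §1 (1)–(2)] -/
theorem uniformisation_apply_zero (hφadd : ∀ x y, φ (x + y) = φ x * φ y) : φ 0 = 1 := by
  have h00 := hφadd 0 0
  rw [add_zero] at h00
  exact mul_eq_left.mp h00.symm

omit [Fintype ι] in
/-- … hence `0 ∈ V/Λ` lies over the origin `e` of `B`. [cite: MumfordAV1970, §1 (1)–(2)] -/
theorem pt_uniformisation_zero (hφadd : ∀ x y, φ (x + y) = φ x * φ y) : (φ 0).pt = origin B := by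
  rw [uniformisation_apply_zero hφadd]
  exact one_left_base _

/-- **TANGENT IDENTIFICATION at the origin (b3)** for the torus uniformisation `φ : V/Λ → B(ℂ)`
(`V = ℂ^{dim B}`, an analytification with `φ (x + y) = φ x * φ y`, ★ `complexAbelianVariety_torusUniformised`
shape) and a `ℂ[ε]`-point `w` through the origin `e`: a UNIQUE `v ∈ V` with
`(s(w)).snd = ∂_v (s ∘ φ ∘ χ₀⁻¹)(χ₀ 0)` for all regular `s` near `e`, where `χ₀⁻¹ = π ∘ Φ⁻¹` (★
`ComplexTorus.chart_symm_apply`, `rfl`), i.e. `∂_v (s ∘ φ ∘ π)`. Special case `P = 0` of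
`existsUnique_tangentVector_of_dualNumber_at`.
[cite: MumfordAV1970, §13 (proof of the Thm. pp. 125–130) and §1 (1)–(2)] [cite: GortzWedhorn2020, (6.3)–(6.4)] -/
theorem existsUnique_tangentVector_of_dualNumber
    (hφ : IsAnalytification (Fin B.dim → ℂ) B.X B.dim φ) (hφadd : ∀ x y, φ (x + y) = φ x * φ y)
    (w : dualNumberOver ⟶ B.X) (hw : dualNumberBasePt w = origin B) :
    ∃! v : Fin B.dim → ℂ, ∀ (U : B.X.left.Opens) (hU : dualNumberBasePt w ∈ U) (s : Γ(B.X.left, U)),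
      (dualNumberStalkHom w (B.X.left.presheaf.germ U _ hU s)).snd =
        fderiv ℂ (fun z ↦ evalOrZero U s (φ ((chartAt (Fin B.dim → ℂ) (0 : ComplexTorus Φ)).symm z)))
          (chartAt (Fin B.dim → ℂ) (0 : ComplexTorus Φ) 0) v :=
  existsUnique_tangentVector_of_dualNumber_at hφ 0 w (hw.trans (pt_uniformisation_zero hφadd).symm)

/-- **b3 backwards (constancy from the tangent vector)** at the origin of the torus uniformisation: if
`v = 0` then `w = toUnit ≫ x`. [cite: MumfordAV1970, §13 (proof of the Thm. pp. 125–130)] -/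
theorem exists_eq_toUnit_comp_of_tangentVector_eq_zero (w : dualNumberOver ⟶ B.X)
    (h0 : ∀ (U : B.X.left.Opens) (hU : dualNumberBasePt w ∈ U) (s : Γ(B.X.left, U)),
      (dualNumberStalkHom w (B.X.left.presheaf.germ U _ hU s)).snd =
        fderiv ℂ (fun z ↦ evalOrZero U s (φ ((chartAt (Fin B.dim → ℂ) (0 : ComplexTorus Φ)).symm z)))
          (chartAt (Fin B.dim → ℂ) (0 : ComplexTorus Φ) 0) 0) :
    ∃ x : 𝟙_ (SchemeOver ℂ) ⟶ B.X, w = CartesianMonoidalCategory.toUnit _ ≫ x :=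
  exists_eq_toUnit_comp_of_tangentVector_eq_zero_at (φ := φ) 0 w h0

end Torus

/-! ## Junction lemmas: base points, translated `ℂ[ε]`-points, `ε`-parts as derivatives along `V` (B-p19 (g10/g11)) -/

section JunctionPoints

/-- `Spec ℂ[ε]` has exactly one point: every prime of `ℂ[ε]` is `(ε)`.
[cite: Hartshorne1977, Ch. II Exercise 2.8 (p. 80)] [cite: GortzWedhorn2020, (6.3)–(6.4)] -/
theorem eq_closedPoint_dualNumber (q : ↥(Spec (CommRingCat.of ℂ[ε]))) :
    q = IsLocalRing.closedPoint (CommRingCat.of ℂ[ε]) := by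
  apply PrimeSpectrum.ext
  change q.asIdeal = IsLocalRing.maximalIdeal ℂ[ε]
  have hle : IsLocalRing.maximalIdeal ℂ[ε] ≤ q.asIdeal := by
    rw [DualNumber.maximalIdeal_eq_span_singleton_eps, Ideal.span_le, Set.singleton_subset_iff]
    refine q.2.mem_of_pow_mem 2 ?_
    rw [pow_two, DualNumber.eps_mul_eps]
    exact q.asIdeal.zero_mem
  exact ((IsLocalRing.maximalIdeal.isMaximal ℂ[ε]).eq_of_le q.2.ne_top hle).symm

variable {Y Y' : SchemeOver ℂ} (w : dualNumberOver ⟶ Y)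

/-- Under the base point of a `ℂ[ε]`-point lies a `ℂ`-point: `w ∘ (ε ↦ 0)`.
[cite: GortzWedhorn2020, (6.3)–(6.4)] -/
theorem exists_point_pt_eq_dualNumberBasePt : ∃ c : AlgPoints Y ℂ, c.pt = dualNumberBasePt w := by
  refine ⟨(CartesianMonoidalCategory.toUnit _ ≫ dualNumberPoint) ≫ w, ?_⟩
  show w.left.base (AlgPoints.pt (CartesianMonoidalCategory.toUnit (specOver ℂ ℂ) ≫ dualNumberPoint)) = w.left.base _
  congr 1
  exact eq_closedPoint_dualNumber _

/-- The base point of `w ≫ g` is `g` of the base point of `w` (definitional). [cite: GortzWedhorn2020, (6.3)–(6.4)] -/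
theorem dualNumberBasePt_comp (g : Y ⟶ Y') : dualNumberBasePt (w ≫ g) = g.left.base (dualNumberBasePt w) := rfl

end JunctionPoints

section JunctionTorus

open Literature.Geometry.Kaehler Literature.Geometry.Kaehler.ComplexTorus

/-- The point of the unit `ℂ`-point is the origin (★ `PrymVariety.pt_one_eq_origin`, re-proved here to keep
the imports small). [folklore] -/
private theorem pt_one_eq_origin' (B : AbelianVariety ℂ) : AlgPoints.pt (1 : B.Points ℂ) = origin B :=
  one_left_base (A := B) (R := ℂ) _

variable {B : AbelianVariety ℂ} {ι₀ : Type} [Fintype ι₀]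
  {Φ : (ι₀ → ℝ) ≃L[ℝ] (Fin B.dim → ℂ)} {φ : ComplexTorus Φ → ComplexPoints B.X}

/-- The base point of the translate `w ≫ t_c` of a `ℂ[ε]`-point `w` through the origin is the point of `c`.
[cite: MumfordAV1970, §13 (proof of the Thm. pp. 125–130)] -/
theorem dualNumberBasePt_comp_translation (w : dualNumberOver ⟶ B.X) (hw : dualNumberBasePt w = origin B)
    (c : B.Points ℂ) : dualNumberBasePt (w ≫ B.translation c) = c.pt := by
  rw [dualNumberBasePt_comp, hw, ← pt_one_eq_origin' B, translation_apply_pt, mul_one]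

/-- Translating back: if `c` lies under the base point of `w`, then `w ≫ t_{c⁻¹}` passes through the origin.
[cite: MumfordAV1970, §13 (proof of the Thm. pp. 125–130)] -/
theorem dualNumberBasePt_comp_translation_inv (w : dualNumberOver ⟶ B.X) {c : B.Points ℂ}
    (hc : c.pt = dualNumberBasePt w) : dualNumberBasePt (w ≫ B.translation c⁻¹) = origin B := by
  rw [dualNumberBasePt_comp, ← hc, translation_apply_pt, inv_mul_cancel, pt_one_eq_origin' B]

omit [Fintype ι₀] in
/-- Regular functions are holomorphic on the universal cover: `y ↦ s(φ(π y))` is complex-differentiable on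
`π⁻¹ φ⁻¹ U(ℂ)`. [cite: SerreGAGA1956, §2 n°6] -/
theorem differentiableOn_evalOrZero_comp_cover [Fintype ι₀] (hφ : IsAnalytification (Fin B.dim → ℂ) B.X B.dim φ)
    (U : B.X.left.Opens) (s : Γ(B.X.left, U)) :
    DifferentiableOn ℂ (fun y ↦ evalOrZero U s (φ (cover Φ y))) (cover Φ ⁻¹' (φ ⁻¹' {P | P.pt ∈ U})) := by
  have hmd := IsAnalytification.mdifferentiableOn_evalOrZero_opens_holds hφ U s
  have h : MDifferentiableOn 𝓘(ℂ, Fin B.dim → ℂ) 𝓘(ℂ, ℂ) (fun y ↦ evalOrZero U s (φ (cover Φ y)))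
      (cover Φ ⁻¹' (φ ⁻¹' {P | P.pt ∈ U})) := fun y hy ↦
    (hmd (cover Φ y) hy).comp y (mdifferentiable_cover Φ (𝕜 := ℂ) y).mdifferentiableWithinAt (fun _ h ↦ h)
  exact mdifferentiableOn_iff_differentiableOn.1 h

/-- **`ε`-parts at translated points are derivatives along the tangent vector `v ∈ V`.**  If the `ℂ[ε]`-point `w₀`
through `e` has tangent vector `v` (b3: its `ε`-parts are `∂_v` at the chart point over `e`), then for every `z ∈ V`
the translate `w₀ ≫ t_{φ(π z)}` has `ε`-parts `∂_v (s ∘ φ ∘ π)` AT `z`: translations act on `V` by translations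
(`φ` is additive, `π` is additive) and `s ∘ φ ∘ π` is `Λ`-periodic. [cite: LangeBirkenhake1992, §1.1.5 (T_0 X = V)]
[cite: MumfordAV1970, §13 (proof of the Thm. pp. 125–130)] -/
theorem snd_dualNumberStalkHom_translation_eq_fderiv (hφadd : ∀ x y, φ (x + y) = φ x * φ y)
    (w₀ : dualNumberOver ⟶ B.X) {v : Fin B.dim → ℂ}
    (hv : ∀ (U : B.X.left.Opens) (hU : dualNumberBasePt w₀ ∈ U) (s : Γ(B.X.left, U)),
      (dualNumberStalkHom w₀ (B.X.left.presheaf.germ U _ hU s)).snd =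
        fderiv ℂ (fun z ↦ evalOrZero U s (φ ((chartAt (Fin B.dim → ℂ) (0 : ComplexTorus Φ)).symm z)))
          (chartAt (Fin B.dim → ℂ) (0 : ComplexTorus Φ) 0) v)
    (z : Fin B.dim → ℂ) (U : B.X.left.Opens)
    (hU : (B.translation (φ (cover Φ z))).left.base (dualNumberBasePt w₀) ∈ U) (s : Γ(B.X.left, U)) :
    (dualNumberStalkHom (w₀ ≫ B.translation (φ (cover Φ z))) (B.X.left.presheaf.germ U _ hU s)).snd =
      fderiv ℂ (fun y ↦ evalOrZero U s (φ (cover Φ y))) z v := by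
  rw [show (dualNumberStalkHom (w₀ ≫ B.translation (φ (cover Φ z))) (B.X.left.presheaf.germ U _ hU s)) =
      dualNumberStalkHom w₀ (B.X.left.presheaf.germ ((B.translation (φ (cover Φ z))).left ⁻¹ᵁ U) (dualNumberBasePt w₀) hU
        ((B.translation (φ (cover Φ z))).left.app U s)) from
    dualNumberStalkHom_comp_germ w₀ (B.translation _) U hU s, hv]
  set G : (Fin B.dim → ℂ) → ℂ := fun y ↦ evalOrZero U s (φ (cover Φ y)) with hG
  have hfun : (fun y ↦ evalOrZero ((B.translation (φ (cover Φ z))).left ⁻¹ᵁ U)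
      ((B.translation (φ (cover Φ z))).left.app U s)
      (φ ((chartAt (Fin B.dim → ℂ) (0 : ComplexTorus Φ)).symm y))) = fun y ↦ G (z + y) := by
    funext y
    have hmap : AlgPoints.map (B.translation (φ (cover Φ z))) (φ (cover Φ y)) = φ (cover Φ (z + y)) := by
      change φ (cover Φ y) ≫ B.translation (φ (cover Φ z)) = _
      rw [comp_translation, ← hφadd, ← cover_add]
    have hy : (chartAt (Fin B.dim → ℂ) (0 : ComplexTorus Φ)).symm y = cover Φ y := rfl
    rw [hy, ← evalOrZero_map_eq_evalOrZero_app, hmap]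
  rw [hfun, fderiv_comp_add_left]
  -- the chart point over `0` is a lattice vector
  obtain ⟨n, hn⟩ : ∃ n : ι₀ → ℤ, chartAt (Fin B.dim → ℂ) (0 : ComplexTorus Φ) 0 = 0 + latticeVec Φ n := by
    rw [← cover_eq_cover_iff, cover_zero]
    exact (chartAt (Fin B.dim → ℂ) (0 : ComplexTorus Φ)).left_inv (mem_chart_source _ 0)
  rw [hn, zero_add]
  have hper : (fun y ↦ G (y + latticeVec Φ n)) = G := by
    funext y
    simp only [hG, cover_add_latticeVec]
  calc fderiv ℂ G (z + latticeVec Φ n) v = fderiv ℂ (fun y ↦ G (y + latticeVec Φ n)) z v := by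
        rw [fderiv_comp_add_right]
    _ = fderiv ℂ G z v := by rw [hper]

end JunctionTorus

end Literature.AlgebraicGeometry.Motives.AbelianVariety

end
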